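import Summits.QuantumFields.BalabanUV.Beta.FP.TorusCompositeRowsPeriodic
import Summits.QuantumFields.BalabanUV.Beta.FP.TorusStepInsertionPeriodic

/-!
# `BalabanUV.Beta.FP.TorusCompositeInsertionPeriodic` — road «FP» for binder row D1, ROUTE T: **THE COMPOSITE FIRST-ORDER INSERTION JET `compIns₁ … n h` ACTS ON
# PERIODIC 1-FORMS AS ANY LATTICE FUNCTIONAL OBEYING OUR CHAIN RULE** — the order-1 composite junction (F4 of an2's S-an2-g49-1 §3), typed against a GENERIC family
# `𝓘` satisfying the displayed recursion, so that the row's `Beta/CompositeFirstOrderTables` object plugs in by its defining equations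

WHY.  `compIns₁ Lc M lev rs n h` (g22 `TorusCompositeCovarianceOne`, OUR ♭ bookkeeping) is defined by the chain rule `compIns₁_succ` (TOP-PEEL: the top step's jet
`stepIns₁` along the TRANSPORTED direction `compRows′ *ᵥ h`, composed with the lower averaging rows, plus the top rows `Qstep` on the lower jet).  Acting on a form
periodic under the finest torus and summing the fine slot, the three torus identities already in the tree — R-1 `TorusCompositeRowsPeriodic.sum_compRows_mul_periodic`
(rows ↦ `(∏ stepScale) · compLinAvgAt`), R-1 `sum_Qstep_mul_periodic`, R-5 `TorusStepInsertionPeriodic.sum_stepIns₁_mul_periodic` (`stepIns₁` ↦ an1's `vhKerAt` at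
(form, lift of the weight)) — turn the chain rule into a recursion of LATTICE forms.  THIS FILE proves: for ANY family `𝓘 lev rs n H B : Form1` with `𝓘 … 0 = 0`, the
displayed successor clause (`hsucc`, OUR recursion verbatim: unit `θ_n`, an1's `vhKerAt` at root `toSite (rs 1)` against the lower composite averages
`compLinAvgAt r′ Lc n` of `B` and `H`, plus `stepScale d Lc (lev 1) · linAvgAt (toSite (rs 1))` of the lower functional) and mapping finest-periodic pairs to top-periodic
forms (`hper`), `Σ_q compIns₁ Lc M lev rs n h (x,κ) q · B q.2 q.1 = 𝓘 lev rs n (lift h) B κ x` — where `lift h l w := h (wrapPt T w, l)` is the periodic lift of the torus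
weight.  No lattice object is DEFINED here (the row's F3 names it); the theorem is the junction for whatever the row defines, by `rfl` on its clauses or by a bridge.

WHAT.  §1 plumbing: `sum_compRows_mul_periodic'` (R-1 at every depth `n ≥ 0` with the canonical bottom-up dictionary `r i := rs (n − i)`), `lift_periodic`,
`periodic_apply_wrap`, `compRows_mulVec_eq` (the transported direction read at a box point is `S · compLinAvgAt` of the lift).  §2 **`sum_compIns₁_mul_periodic`**.
NOT HERE: the row's definition and its bridge; the kernel-level packaging (R-2's pattern, entries via periodic indicators); order 2 (R-6 at the top); estimates.

[folklore] finite sums BY NAME over OUR bookkeeping objects (`compIns₁ ∕ stepIns₁ ∕ compRows ∕ Qstep ∕ towerTorus`) and the row's ∕ an1's typed lattice objects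
(`compLinAvgAt`, `linAvgAt`, `vhKerAt`); no `def`, no `def … : Prop`, nothing cited, 0 sorry; NO chart; nothing of Bałaban's asserted (that the composite's first
variation IS this chain is an2's (C1) TABLE word, R-D1-g42-4).

HONEST DEPENDENCY (page 1, mandatory): continuum YM on T⁴ ⇐ BetaPertH ∧ nine spine estimates (0/9 proved); BetaPertH ⇐ (D1) ∧ (D4) ∧ CAP+tail;
G-an2-4 gates asym, D1 and NE2/3/4.  HONEST FRAMING (cell contract, verbatim): «discharging `BetaPertH` makes Bałaban's UV stability UNCONDITIONAL —
a real constructive-QFT result; it is NOT the continuum limit and NOT the Clay problem.»  ABSOLUTE RULE (cell charter, verbatim): «No internally-minted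
statement may enter as a cited fact. Every hypothesis is either kernel-proved in this package or a verbatim quotation of a PUBLISHED theorem with page
reference. The manuscript(s) under audit are NOT citable for their own disputed steps — they are the thing under adjudication; programme-internal
(2001/route/tribunal) claims are never citable.»  0 estimates; 0∕4 row-D1 binders (hW, hR, D1Tel, D1Rep); NOT (T-ID), NOT (C1), NOT SDF, NOT D1,
NOT BetaPertH, NOT continuum, NOT Clay.  D1 formalisation swarm LEAF PROVER 02 (b2b-balaban-beta-d1-formalise-leaf-02 gen 28), 2026-08-23.  No existing file touched.
-/

noncomputable section

open scoped BigOperators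

namespace Summit.QuantumFields.BalabanUV.Beta.FP.TorusCompositeInsertionPeriodic

open Matrix Finset
open Literature.MathematicalPhysics.QuantumFieldTheory
open Literature.MathematicalPhysics.QuantumFieldTheory.Balaban1983to89
open Literature.MathematicalPhysics.QuantumFieldTheory.Balaban1983to89.Beta
open B5Prop11Plancherel (fine)
open B6Lemma24Torus (pbox mem_pbox wrap wrap_congr)
open B4TorusKernel.MultiPeriod (translate translate_apply)
open AffineAveraging (Site Form1 box toSite)
open AveragingContoursRooted (linAvgAt)
open AveragingHessianKernels (Bond)
open AveragingHessianKernelsRooted (vhKerAt)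
open Summit.QuantumFields.BalabanUV.Beta.BorderedHessian (stepScale)
open Summit.QuantumFields.BalabanUV.Beta.FP.TorusGaugeCovariancePairing (wrapPt wrapPt_coe wrapPt_of_mem)
open Summit.QuantumFields.BalabanUV.Beta.FP.TorusCompositeObjects (towerTorus towerTorus_apply Qstep compRows compRows_succ compRows_zero)
open Summit.QuantumFields.BalabanUV.Beta.CompositeAveragingCoarseExact (compLinAvgAt compLinAvgAt_zero)
open Summit.QuantumFields.BalabanUV.Beta.FP.TorusCompositeRowsPeriodic (sum_Qstep_mul_periodic compLinAvgAt_periodic sum_compRows_mul_periodic)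
open Summit.QuantumFields.BalabanUV.Beta.FP.TorusCompositeCovarianceOne (stepIns₁ compIns₁ compIns₁_zero compIns₁_succ)
open Summit.QuantumFields.BalabanUV.Beta.FP.TorusStepInsertionPeriodic (sum_stepIns₁_mul_periodic)

variable {d : ℕ} (Lc : ℕ) [NeZero Lc]

/-! ## §1 Plumbing: R-1 at every depth with the canonical dictionary; the periodic lift of a torus weight; the transported direction -/

/-- [folklore] R-1 `sum_compRows_mul_periodic` AT EVERY DEPTH `n ≥ 0`, with the canonical bottom-up root dictionary `r i := rs (n − i)`:
`Σ_q compRows Lc M lev rs n (x,κ) q · A q.2 q.1 = (∏_{i<n} stepScale d Lc (lev (i+1))) · compLinAvgAt (fun i => rs (n − i)) Lc n A κ x` (depth `0`: both sides are `A κ x`). -/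
theorem sum_compRows_mul_periodic' : ∀ (n : ℕ) (M : Fin (d + 1) → ℕ) [∀ μ, NeZero (M μ)] (lev : ℕ → ℕ) (rs : ℕ → (Fin (d + 1) → ℕ))
    (_ : ∀ k, rs k ∈ box (d + 1) Lc) (A : Form1 (d + 1) ℝ)
    (_ : ∀ (l : Fin (d + 1)) (w t : Fin (d + 1) → ℤ), A l (translate (towerTorus Lc M n) w t) = A l w) (x : ↥(pbox M)) (κ : Fin (d + 1)),
    ∑ q : ↥(pbox (towerTorus Lc M n)) × Fin (d + 1), compRows Lc M lev rs n (x, κ) q * A q.2 (q.1 : Site (d + 1))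
      = (∏ i ∈ Finset.range n, stepScale d Lc (lev (i + 1))) * compLinAvgAt (fun i => rs (n - i)) Lc n A κ (x : Site (d + 1))
  | 0, M, _, lev, rs, hrs, A, hA, x, κ => by
      classical
      show ∑ q : ↥(pbox M) × Fin (d + 1), compRows Lc M lev rs 0 (x, κ) q * A q.2 (q.1 : Site (d + 1)) = _
      rw [Finset.prod_range_zero, one_mul, compLinAvgAt_zero, compRows_zero]
      simp only [Matrix.one_apply, ite_mul, one_mul, zero_mul, Finset.sum_ite_eq, Finset.mem_univ, if_true]
  | n + 1, M, _, lev, rs, hrs, A, hA, x, κ =>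
      sum_compRows_mul_periodic Lc n M lev rs hrs (fun i => rs (n + 1 - i)) (fun i j hij => by
        show rs (n + 1 - i) = rs (j + 1)
        congr 1; omega) A hA x κ

/-- [folklore] the periodic LIFT `(l, w) ↦ h (wrapPt T w, l)` of a torus weight is `T`-periodic (`wrap_congr`). -/
theorem lift_periodic (T : Fin (d + 1) → ℕ) [∀ μ, NeZero (T μ)] (h : ↥(pbox T) × Fin (d + 1) → ℝ) (l : Fin (d + 1)) (w t : Site (d + 1)) :
    h (wrapPt T (translate T w t), l) = h (wrapPt T w, l) := by
  congr 2
  refine Subtype.ext (wrap_congr fun i => ?_)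
  rw [translate_apply]
  exact ⟨t i, by ring⟩

/-- [folklore] a `T`-periodic form does not see the box representative: `F l (wrap T u) = F l u`. -/
theorem periodic_apply_wrap (T : Fin (d + 1) → ℕ) [∀ μ, NeZero (T μ)] (F : Form1 (d + 1) ℝ)
    (hF : ∀ (l : Fin (d + 1)) (y m : Site (d + 1)), F l (translate T y m) = F l y) (l : Fin (d + 1)) (u : Site (d + 1)) :
    F l ((wrapPt T u : ↥(pbox T)) : Site (d + 1)) = F l u := by
  have hm : ∃ m : Site (d + 1), ((wrapPt T u : ↥(pbox T)) : Site (d + 1)) = translate T u m := by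
    refine ⟨fun i => -(u i / (T i : ℤ)), funext fun i => ?_⟩
    have h := Int.mul_ediv_add_emod (u i) (T i : ℤ)
    rw [wrapPt_coe, translate_apply, mul_neg]
    simp only [wrap]
    linarith
  obtain ⟨m, hm⟩ := hm
  rw [hm, hF]

/-- [folklore] **THE TRANSPORTED DIRECTION**: the tower's averaging rows applied to a torus weight, read at any slot, are `(∏ stepScale) ·` the lattice composite average of
its periodic lift: `(compRows Lc M lev rs n *ᵥ h) (x, κ) = (∏_{i<n} stepScale d Lc (lev (i+1))) · compLinAvgAt (fun i => rs (n − i)) Lc n (lift h) κ x`. -/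
theorem compRows_mulVec_eq (n : ℕ) (M : Fin (d + 1) → ℕ) [∀ μ, NeZero (M μ)] (lev : ℕ → ℕ) (rs : ℕ → (Fin (d + 1) → ℕ))
    (hrs : ∀ k, rs k ∈ box (d + 1) Lc) (h : ↥(pbox (towerTorus Lc M n)) × Fin (d + 1) → ℝ) (x : ↥(pbox M)) (κ : Fin (d + 1)) :
    (compRows Lc M lev rs n *ᵥ h) (x, κ)
      = (∏ i ∈ Finset.range n, stepScale d Lc (lev (i + 1))) *
          compLinAvgAt (fun i => rs (n - i)) Lc n (fun l w => h (wrapPt (towerTorus Lc M n) w, l)) κ (x : Site (d + 1)) := by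
  rw [Matrix.mulVec, dotProduct, ← sum_compRows_mul_periodic' Lc n M lev rs hrs _ (fun l w t => lift_periodic (towerTorus Lc M n) h l w t) x κ]
  refine Finset.sum_congr rfl fun q _ => ?_
  show _ = compRows Lc M lev rs n (x, κ) q * h (wrapPt (towerTorus Lc M n) (q.1 : Site (d + 1)), q.2)
  rw [wrapPt_of_mem]

/-! ## §2 The composite first-order insertion jet acts on periodic forms as any functional obeying our chain rule -/

/-- [folklore] **`sum_compIns₁_mul_periodic` — THE COMPOSITE FIRST-ORDER INSERTION JET ACTS ON PERIODIC 1-FORMS AS ANY LATTICE FUNCTIONAL OBEYING OUR CHAIN RULE.**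
Let `𝓘 lev rs n H B : Form1 (d+1) ℝ` be any family with: `h0` — depth `0` is `0`; `hsucc` — OUR successor clause, VERBATIM from `compIns₁_succ` read through R-1 ∕ R-5:
`𝓘 lev rs (n+1) H B κ x = θ_n · Σ'_u Σ_{κ′} (Σ'_z Σ_l vhKerAt (toSite (rs 1)) Lc κ x (l,z) (κ′,u) · (S′ · compLinAvgAt r′ Lc n B l z)) · (S′ · compLinAvgAt r′ Lc n H κ′ u)
 + stepScale d Lc (lev 1) · linAvgAt (toSite (rs 1)) (𝓘 (lev∘succ) (rs∘succ) n H B) Lc κ x`,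
`θ_n = (Lc^{d+1}·stepScale d Lc (lev 1))·(∏_{i<n} (stepScale d Lc (lev (i+2))·#B))⁻¹`, `S′ = ∏_{i<n} stepScale d Lc (lev (i+2))`, `r′ i = rs (n − i + 1)`; `hper` — for
forms `H, B` periodic under the finest torus `towerTorus Lc M n`, `𝓘 lev rs n H B` is periodic under the top box `M`.  Then for every tower (`rs k ∈ box`), every torus
weight `h` on the finest torus and every finest-periodic real 1-form `B`:
`Σ_q compIns₁ Lc M lev rs n h (x, κ) q · B q.2 q.1 = 𝓘 lev rs n (fun l w => h (wrapPt (towerTorus Lc M n) w, l)) B κ x`. -/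
theorem sum_compIns₁_mul_periodic
    (𝓘 : (ℕ → ℕ) → (ℕ → (Fin (d + 1) → ℕ)) → ℕ → Form1 (d + 1) ℝ → Form1 (d + 1) ℝ → Form1 (d + 1) ℝ)
    (h0 : ∀ (lev : ℕ → ℕ) (rs : ℕ → (Fin (d + 1) → ℕ)) (H B : Form1 (d + 1) ℝ), 𝓘 lev rs 0 H B = 0)
    (hsucc : ∀ (lev : ℕ → ℕ) (rs : ℕ → (Fin (d + 1) → ℕ)) (n : ℕ) (H B : Form1 (d + 1) ℝ) (κ : Fin (d + 1)) (x : Site (d + 1)),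
      𝓘 lev rs (n + 1) H B κ x
        = (((Lc : ℝ) ^ (d + 1) * stepScale d Lc (lev 1)) * (∏ i ∈ Finset.range n, (stepScale d Lc (lev (i + 1 + 1)) * ((box (d + 1) Lc).card : ℝ)))⁻¹) *
            (∑' u : Site (d + 1), ∑ κ' : Fin (d + 1),
              (∑' z : Site (d + 1), ∑ l : Fin (d + 1), vhKerAt (toSite (rs 1)) Lc κ x (l, z) (κ', u) *
                ((∏ i ∈ Finset.range n, stepScale d Lc (lev (i + 1 + 1))) * compLinAvgAt (fun i => rs (n - i + 1)) Lc n B l z)) *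
              ((∏ i ∈ Finset.range n, stepScale d Lc (lev (i + 1 + 1))) * compLinAvgAt (fun i => rs (n - i + 1)) Lc n H κ' u))
          + stepScale d Lc (lev 1) * linAvgAt (toSite (rs 1)) (𝓘 (fun k => lev (k + 1)) (fun k => rs (k + 1)) n H B) Lc κ x)
    (hper : ∀ (lev : ℕ → ℕ) (rs : ℕ → (Fin (d + 1) → ℕ)) (n : ℕ) (M : Fin (d + 1) → ℕ) (H B : Form1 (d + 1) ℝ),
      (∀ (l : Fin (d + 1)) (w t : Site (d + 1)), H l (translate (towerTorus Lc M n) w t) = H l w) →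
      (∀ (l : Fin (d + 1)) (w t : Site (d + 1)), B l (translate (towerTorus Lc M n) w t) = B l w) →
      ∀ (l : Fin (d + 1)) (y t : Site (d + 1)), 𝓘 lev rs n H B l (translate M y t) = 𝓘 lev rs n H B l y) :
    ∀ (n : ℕ) (M : Fin (d + 1) → ℕ) [∀ μ, NeZero (M μ)] (lev : ℕ → ℕ) (rs : ℕ → (Fin (d + 1) → ℕ)) (_ : ∀ k, rs k ∈ box (d + 1) Lc)
      (h : ↥(pbox (towerTorus Lc M n)) × Fin (d + 1) → ℝ) (B : Form1 (d + 1) ℝ)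
      (_ : ∀ (l : Fin (d + 1)) (w t : Site (d + 1)), B l (translate (towerTorus Lc M n) w t) = B l w) (x : ↥(pbox M)) (κ : Fin (d + 1)),
      ∑ q : ↥(pbox (towerTorus Lc M n)) × Fin (d + 1), compIns₁ Lc M lev rs n h (x, κ) q * B q.2 (q.1 : Site (d + 1))
        = 𝓘 lev rs n (fun l w => h (wrapPt (towerTorus Lc M n) w, l)) B κ (x : Site (d + 1))
  | 0, M, _, lev, rs, hrs, h, B, hB, x, κ => by
      rw [h0, compIns₁_zero]
      simp only [Matrix.zero_apply, zero_mul, Finset.sum_const_zero]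
      rfl
  | n + 1, M, _, lev, rs, hrs, h, B, hB, x, κ => by
      -- spell every finest-torus object over the lower tower `(fine Lc M, n)` (definitionally the same torus, `towerTorus_succ`)
      change ↥(pbox (towerTorus Lc (fine Lc M) n)) × Fin (d + 1) → ℝ at h
      change ∀ (l : Fin (d + 1)) (w t : Site (d + 1)), B l (translate (towerTorus Lc (fine Lc M) n) w t) = B l w at hB
      show ∑ q : ↥(pbox (towerTorus Lc (fine Lc M) n)) × Fin (d + 1), compIns₁ Lc M lev rs (n + 1) h (x, κ) q * B q.2 (q.1 : Site (d + 1))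
        = 𝓘 lev rs (n + 1) (fun l w => h (wrapPt (towerTorus Lc (fine Lc M) n) w, l)) B κ (x : Site (d + 1))
      -- the lifted direction is finest-periodic
      have hHper : ∀ (l : Fin (d + 1)) (w t : Site (d + 1)),
          (fun l w => h (wrapPt (towerTorus Lc (fine Lc M) n) w, l)) l (translate (towerTorus Lc (fine Lc M) n) w t)
            = (fun l w => h (wrapPt (towerTorus Lc (fine Lc M) n) w, l)) l w := fun l w t => lift_periodic (towerTorus Lc (fine Lc M) n) h l w t
      -- induction hypothesis on the lower tower (top `fine Lc M`, depth `n`, same finest torus)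
      have IH := sum_compIns₁_mul_periodic 𝓘 h0 hsucc hper n (fine Lc M) (fun k => lev (k + 1)) (fun k => rs (k + 1)) (fun k => hrs (k + 1)) h B hB
      -- the lower functional is `fine Lc M`-periodic
      have hIper : ∀ (l : Fin (d + 1)) (y t : Site (d + 1)),
          𝓘 (fun k => lev (k + 1)) (fun k => rs (k + 1)) n (fun l w => h (wrapPt (towerTorus Lc (fine Lc M) n) w, l)) B l (translate (fine Lc M) y t)
            = 𝓘 (fun k => lev (k + 1)) (fun k => rs (k + 1)) n (fun l w => h (wrapPt (towerTorus Lc (fine Lc M) n) w, l)) B l y :=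
        hper _ _ n (fine Lc M) _ B hHper hB
      -- the lower composite averages of `B` and of `H` are `fine Lc M`-periodic
      have hBlow : ∀ (l : Fin (d + 1)) (y t : Site (d + 1)),
          compLinAvgAt (fun i => rs (n - i + 1)) Lc n B l (translate (fine Lc M) y t) = compLinAvgAt (fun i => rs (n - i + 1)) Lc n B l y :=
        compLinAvgAt_periodic Lc (fine Lc M) n _ B hB
      set S' : ℝ := ∏ i ∈ Finset.range n, stepScale d Lc (lev (i + 1 + 1)) with hS'
      have hBlow' : ∀ (l : Fin (d + 1)) (y t : Site (d + 1)),
          (fun l z => S' * compLinAvgAt (fun i => rs (n - i + 1)) Lc n B l z) l (translate (fine Lc M) y t)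
            = (fun l z => S' * compLinAvgAt (fun i => rs (n - i + 1)) Lc n B l z) l y := fun l y t => by
        show S' * _ = S' * _
        rw [hBlow]
      -- the transported direction read at a box point of `fine Lc M`
      have hv : ∀ (u : Site (d + 1)) (κ' : Fin (d + 1)),
          (compRows Lc (fine Lc M) (fun k => lev (k + 1)) (fun k => rs (k + 1)) n *ᵥ h) (wrapPt (fine Lc M) u, κ')
            = S' * compLinAvgAt (fun i => rs (n - i + 1)) Lc n (fun l w => h (wrapPt (towerTorus Lc (fine Lc M) n) w, l)) κ' u := fun u κ' => by
        rw [compRows_mulVec_eq Lc n (fine Lc M) (fun k => lev (k + 1)) (fun k => rs (k + 1)) (fun k => hrs (k + 1)) h (wrapPt (fine Lc M) u) κ']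
        exact congrArg (fun t : ℝ => S' * t) (periodic_apply_wrap (fine Lc M) _ (compLinAvgAt_periodic Lc (fine Lc M) n _ _ hHper) κ' u)
      -- the two lower actions on the slots of `fine Lc M`: the rows (R-1) and the lower jet (induction hypothesis)
      have hrows : ∀ p : ↥(pbox (fine Lc M)) × Fin (d + 1),
          ∑ q : ↥(pbox (towerTorus Lc (fine Lc M) n)) × Fin (d + 1), compRows Lc (fine Lc M) (fun k => lev (k + 1)) (fun k => rs (k + 1)) n p q * B q.2 (q.1 : Site (d + 1))
            = (fun l z => S' * compLinAvgAt (fun i => rs (n - i + 1)) Lc n B l z) p.2 (p.1 : Site (d + 1)) := fun p => by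
        obtain ⟨y, l⟩ := p
        exact sum_compRows_mul_periodic' Lc n (fine Lc M) (fun k => lev (k + 1)) (fun k => rs (k + 1)) (fun k => hrs (k + 1)) B hB y l
      have hlow : ∀ p : ↥(pbox (fine Lc M)) × Fin (d + 1),
          ∑ q : ↥(pbox (towerTorus Lc (fine Lc M) n)) × Fin (d + 1), compIns₁ Lc (fine Lc M) (fun k => lev (k + 1)) (fun k => rs (k + 1)) n h p q * B q.2 (q.1 : Site (d + 1))
            = 𝓘 (fun k => lev (k + 1)) (fun k => rs (k + 1)) n (fun l w => h (wrapPt (towerTorus Lc (fine Lc M) n) w, l)) B p.2 (p.1 : Site (d + 1)) := fun p => by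
        obtain ⟨y, l⟩ := p
        exact IH y l
      -- the chain rule, entrywise: split the top term and the lower term
      rw [hsucc, compIns₁_succ]
      simp only [Matrix.add_apply, add_mul, Finset.sum_add_distrib]
      congr 1
      · -- TOP TERM: peel the unit, push the lower rows through (R-1), then `stepIns₁` acts as `vhKerAt` at (that form, the lift of the transported direction) (R-5)
        have e1 : ∀ q : ↥(pbox (towerTorus Lc (fine Lc M) n)) × Fin (d + 1),
            ((((Lc : ℝ) ^ (d + 1) * stepScale d Lc (lev 1)) * (∏ i ∈ Finset.range n, (stepScale d Lc (lev (i + 1 + 1)) * ((box (d + 1) Lc).card : ℝ)))⁻¹) •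
                (stepIns₁ M Lc (rs 1) ((compRows Lc (fine Lc M) (fun k => lev (k + 1)) (fun k => rs (k + 1)) n) *ᵥ h)
                  * compRows Lc (fine Lc M) (fun k => lev (k + 1)) (fun k => rs (k + 1)) n)) (x, κ) q * B q.2 (q.1 : Site (d + 1))
              = (((Lc : ℝ) ^ (d + 1) * stepScale d Lc (lev 1)) * (∏ i ∈ Finset.range n, (stepScale d Lc (lev (i + 1 + 1)) * ((box (d + 1) Lc).card : ℝ)))⁻¹) *
                ((stepIns₁ M Lc (rs 1) ((compRows Lc (fine Lc M) (fun k => lev (k + 1)) (fun k => rs (k + 1)) n) *ᵥ h)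
                  * compRows Lc (fine Lc M) (fun k => lev (k + 1)) (fun k => rs (k + 1)) n) (x, κ) q * B q.2 (q.1 : Site (d + 1))) := fun q => by
          rw [Matrix.smul_apply, smul_eq_mul, mul_assoc]
        rw [Finset.sum_congr rfl (fun q _ => e1 q), ← Finset.mul_sum]
        congr 1
        calc ∑ q : ↥(pbox (towerTorus Lc (fine Lc M) n)) × Fin (d + 1),
              (stepIns₁ M Lc (rs 1) ((compRows Lc (fine Lc M) (fun k => lev (k + 1)) (fun k => rs (k + 1)) n) *ᵥ h)
                * compRows Lc (fine Lc M) (fun k => lev (k + 1)) (fun k => rs (k + 1)) n) (x, κ) q * B q.2 (q.1 : Site (d + 1))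
            = ∑ p : ↥(pbox (fine Lc M)) × Fin (d + 1), stepIns₁ M Lc (rs 1) ((compRows Lc (fine Lc M) (fun k => lev (k + 1)) (fun k => rs (k + 1)) n) *ᵥ h) (x, κ) p *
                ∑ q : ↥(pbox (towerTorus Lc (fine Lc M) n)) × Fin (d + 1), compRows Lc (fine Lc M) (fun k => lev (k + 1)) (fun k => rs (k + 1)) n p q * B q.2 (q.1 : Site (d + 1)) := by
              simp only [Matrix.mul_apply, Finset.sum_mul, Finset.mul_sum, mul_assoc]
              exact Finset.sum_comm
          _ = ∑ p : ↥(pbox (fine Lc M)) × Fin (d + 1), stepIns₁ M Lc (rs 1) ((compRows Lc (fine Lc M) (fun k => lev (k + 1)) (fun k => rs (k + 1)) n) *ᵥ h) (x, κ) p *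
                (fun l z => S' * compLinAvgAt (fun i => rs (n - i + 1)) Lc n B l z) p.2 (p.1 : Site (d + 1)) :=
              Finset.sum_congr rfl fun p _ => by rw [hrows p]
          _ = _ := (sum_stepIns₁_mul_periodic M Lc (hrs 1) ((compRows Lc (fine Lc M) (fun k => lev (k + 1)) (fun k => rs (k + 1)) n) *ᵥ h)
                (fun l z => S' * compLinAvgAt (fun i => rs (n - i + 1)) Lc n B l z) hBlow' x κ).trans
              (tsum_congr fun u => Finset.sum_congr rfl fun κ' _ => by rw [hv u κ'])
      · -- LOWER TERM: the top rows act as `stepScale · linAvgAt` on the (periodic) lower functional (R-1 `sum_Qstep_mul_periodic`)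
        calc ∑ q : ↥(pbox (towerTorus Lc (fine Lc M) n)) × Fin (d + 1), (Qstep Lc M (lev 1) (rs 1) * compIns₁ Lc (fine Lc M) (fun k => lev (k + 1)) (fun k => rs (k + 1)) n h) (x, κ) q * B q.2 (q.1 : Site (d + 1))
            = ∑ p : ↥(pbox (fine Lc M)) × Fin (d + 1), Qstep Lc M (lev 1) (rs 1) (x, κ) p *
                ∑ q : ↥(pbox (towerTorus Lc (fine Lc M) n)) × Fin (d + 1), compIns₁ Lc (fine Lc M) (fun k => lev (k + 1)) (fun k => rs (k + 1)) n h p q * B q.2 (q.1 : Site (d + 1)) := by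
              simp only [Matrix.mul_apply, Finset.sum_mul, Finset.mul_sum, mul_assoc]
              exact Finset.sum_comm
          _ = ∑ p : ↥(pbox (fine Lc M)) × Fin (d + 1), Qstep Lc M (lev 1) (rs 1) (x, κ) p *
                𝓘 (fun k => lev (k + 1)) (fun k => rs (k + 1)) n (fun l w => h (wrapPt (towerTorus Lc (fine Lc M) n) w, l)) B p.2 (p.1 : Site (d + 1)) :=
              Finset.sum_congr rfl fun p _ => by rw [hlow p]
          _ = _ := sum_Qstep_mul_periodic Lc M (lev 1) (hrs 1)
              (𝓘 (fun k => lev (k + 1)) (fun k => rs (k + 1)) n (fun l w => h (wrapPt (towerTorus Lc (fine Lc M) n) w, l)) B) hIper x κ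


/-! ## §3 The periodicity letter `hper` FOLLOWS from the clauses: a functional obeying our chain rule maps finest-periodic pairs to top-periodic forms -/

omit [NeZero Lc] in
/-- [folklore] the top summand of the successor clause is periodic under the top box: for forms `W`, `B′` periodic under `fine Lc M`, the `vhKerAt` double form
`x ↦ Σ'_u Σ_{κ′} (Σ'_z Σ_l vhKerAt ρ Lc κ x (l,z) (κ′,u) · B′ l z) · W κ′ u` is `M`-periodic (an1's block-translation covariance `vhKerAt_add`, re-indexing both bond sums
by `Equiv.addRight`). -/
theorem vhKerAt_form_translate (M : Fin (d + 1) → ℕ) (ρ : Site (d + 1)) (W B' : Form1 (d + 1) ℝ)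
    (hW : ∀ (l : Fin (d + 1)) (y m : Site (d + 1)), W l (translate (fine Lc M) y m) = W l y)
    (hB' : ∀ (l : Fin (d + 1)) (y m : Site (d + 1)), B' l (translate (fine Lc M) y m) = B' l y) (κ : Fin (d + 1)) (y t : Site (d + 1)) :
    (∑' u : Site (d + 1), ∑ κ' : Fin (d + 1), (∑' z : Site (d + 1), ∑ l : Fin (d + 1), vhKerAt ρ Lc κ (translate M y t) (l, z) (κ', u) * B' l z) * W κ' u)
      = ∑' u : Site (d + 1), ∑ κ' : Fin (d + 1), (∑' z : Site (d + 1), ∑ l : Fin (d + 1), vhKerAt ρ Lc κ y (l, z) (κ', u) * B' l z) * W κ' u := by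
  -- the block translation `t` of the coarse site is the fine translation of both bonds (an1's `vhKerAt_add`)
  have eadd : ∀ w : Site (d + 1), (w + (fun i => (fine Lc M i : ℤ) * t i)) = translate (fine Lc M) w t := fun w => by
    funext i; simp [B4TorusKernel.MultiPeriod.translate_apply]
  have hK : ∀ (l : Fin (d + 1)) (z : Site (d + 1)) (κ' : Fin (d + 1)) (u : Site (d + 1)),
      vhKerAt ρ Lc κ (translate M y t) (l, translate (fine Lc M) z t) (κ', translate (fine Lc M) u t) = vhKerAt ρ Lc κ y (l, z) (κ', u) := by
    intro l z κ' u
    have hy : translate M y t = y + fun i => (M i : ℤ) * t i := by funext i; simp [B4TorusKernel.MultiPeriod.translate_apply]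
    have hz : ((l, translate (fine Lc M) z t) : Bond (d + 1)) = AveragingHessianKernels.Bond.sh (l, z) ((Lc : ℤ) • fun i => (M i : ℤ) * t i) :=
      Prod.ext rfl (funext fun i => by simp [B4TorusKernel.MultiPeriod.translate_apply, fine, Nat.cast_mul, mul_assoc])
    have hu : ((κ', translate (fine Lc M) u t) : Bond (d + 1)) = AveragingHessianKernels.Bond.sh (κ', u) ((Lc : ℤ) • fun i => (M i : ℤ) * t i) :=
      Prod.ext rfl (funext fun i => by simp [B4TorusKernel.MultiPeriod.translate_apply, fine, Nat.cast_mul, mul_assoc])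
    rw [hy, hz, hu]
    exact AveragingHessianKernelsRooted.vhKerAt_add ρ Lc κ y (fun i => (M i : ℤ) * t i) (l, z) (κ', u)
  -- re-index both lattice sums by the fine translation
  rw [← (Equiv.addRight (fun i => (fine Lc M i : ℤ) * t i)).tsum_eq (fun u => ∑ κ' : Fin (d + 1),
    (∑' z : Site (d + 1), ∑ l : Fin (d + 1), vhKerAt ρ Lc κ (translate M y t) (l, z) (κ', u) * B' l z) * W κ' u)]
  refine tsum_congr fun u => Finset.sum_congr rfl fun κ' _ => ?_
  simp only [Equiv.coe_addRight]
  rw [eadd u, hW]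
  refine congrArg (fun s : ℝ => s * W κ' u) ?_
  rw [← (Equiv.addRight (fun i => (fine Lc M i : ℤ) * t i)).tsum_eq (fun z => ∑ l : Fin (d + 1),
    vhKerAt ρ Lc κ (translate M y t) (l, z) (κ', translate (fine Lc M) u t) * B' l z)]
  refine tsum_congr fun z => Finset.sum_congr rfl fun l _ => ?_
  simp only [Equiv.coe_addRight]
  rw [eadd z, hB', hK]

omit [NeZero Lc] in
/-- [folklore] the lower summand is periodic under the top box when the lower functional is periodic under `fine Lc M` (an1's `linAvgAt_add`). -/
theorem linAvgAt_translate_of_periodic (M : Fin (d + 1) → ℕ) (ρ : Site (d + 1)) (F : Form1 (d + 1) ℝ)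
    (hF : ∀ (l : Fin (d + 1)) (y m : Site (d + 1)), F l (translate (fine Lc M) y m) = F l y) (κ : Fin (d + 1)) (y t : Site (d + 1)) :
    linAvgAt ρ F Lc κ (translate M y t) = linAvgAt ρ F Lc κ y := by
  rw [show translate M y t = y + fun i => (M i : ℤ) * t i by funext i; simp [B4TorusKernel.MultiPeriod.translate_apply],
    AveragingContoursRooted.linAvgAt_add]
  congr 1
  funext l u
  show F l (u + (Lc : ℤ) • fun i => (M i : ℤ) * t i) = F l u
  rw [show (u + (Lc : ℤ) • fun i => (M i : ℤ) * t i) = translate (fine Lc M) u t by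
    funext i; simp only [Pi.add_apply, Pi.smul_apply, smul_eq_mul, translate_apply, fine, Nat.cast_mul]; ring]
  exact hF l u t

omit [NeZero Lc] in
/-- [folklore] **`periodic_of_clauses` — THE LETTER `hper` OF `sum_compIns₁_mul_periodic` FOLLOWS FROM `h0` AND `hsucc`**: a family obeying our chain rule maps pairs
of forms periodic under the finest torus `towerTorus Lc M n` to a form periodic under the top box `M` (induction: `vhKerAt_form_translate` on the top summand over
`compLinAvgAt_periodic`, `linAvgAt_translate_of_periodic` on the lower one). -/
theorem periodic_of_clauses
    (𝓘 : (ℕ → ℕ) → (ℕ → (Fin (d + 1) → ℕ)) → ℕ → Form1 (d + 1) ℝ → Form1 (d + 1) ℝ → Form1 (d + 1) ℝ)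
    (h0 : ∀ (lev : ℕ → ℕ) (rs : ℕ → (Fin (d + 1) → ℕ)) (H B : Form1 (d + 1) ℝ), 𝓘 lev rs 0 H B = 0)
    (hsucc : ∀ (lev : ℕ → ℕ) (rs : ℕ → (Fin (d + 1) → ℕ)) (n : ℕ) (H B : Form1 (d + 1) ℝ) (κ : Fin (d + 1)) (x : Site (d + 1)),
      𝓘 lev rs (n + 1) H B κ x
        = (((Lc : ℝ) ^ (d + 1) * stepScale d Lc (lev 1)) * (∏ i ∈ Finset.range n, (stepScale d Lc (lev (i + 1 + 1)) * ((box (d + 1) Lc).card : ℝ)))⁻¹) *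
            (∑' u : Site (d + 1), ∑ κ' : Fin (d + 1),
              (∑' z : Site (d + 1), ∑ l : Fin (d + 1), vhKerAt (toSite (rs 1)) Lc κ x (l, z) (κ', u) *
                ((∏ i ∈ Finset.range n, stepScale d Lc (lev (i + 1 + 1))) * compLinAvgAt (fun i => rs (n - i + 1)) Lc n B l z)) *
              ((∏ i ∈ Finset.range n, stepScale d Lc (lev (i + 1 + 1))) * compLinAvgAt (fun i => rs (n - i + 1)) Lc n H κ' u))
          + stepScale d Lc (lev 1) * linAvgAt (toSite (rs 1)) (𝓘 (fun k => lev (k + 1)) (fun k => rs (k + 1)) n H B) Lc κ x) :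
    ∀ (n : ℕ) (lev : ℕ → ℕ) (rs : ℕ → (Fin (d + 1) → ℕ)) (M : Fin (d + 1) → ℕ) (H B : Form1 (d + 1) ℝ),
      (∀ (l : Fin (d + 1)) (w t : Site (d + 1)), H l (translate (towerTorus Lc M n) w t) = H l w) →
      (∀ (l : Fin (d + 1)) (w t : Site (d + 1)), B l (translate (towerTorus Lc M n) w t) = B l w) →
      ∀ (l : Fin (d + 1)) (y t : Site (d + 1)), 𝓘 lev rs n H B l (translate M y t) = 𝓘 lev rs n H B l y := by
  intro n
  induction n with
  | zero => intro lev rs M H B _ _ l y t; rw [h0]; rfl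
  | succ n IH =>
      intro lev rs M H B hH hB l y t
      change ∀ (l : Fin (d + 1)) (w t : Site (d + 1)), H l (translate (towerTorus Lc (fine Lc M) n) w t) = H l w at hH
      change ∀ (l : Fin (d + 1)) (w t : Site (d + 1)), B l (translate (towerTorus Lc (fine Lc M) n) w t) = B l w at hB
      have IH' := IH (fun k => lev (k + 1)) (fun k => rs (k + 1)) (fine Lc M) H B hH hB
      have hBl : ∀ (l : Fin (d + 1)) (y m : Site (d + 1)),
          (fun l z => (∏ i ∈ Finset.range n, stepScale d Lc (lev (i + 1 + 1))) * compLinAvgAt (fun i => rs (n - i + 1)) Lc n B l z) l (translate (fine Lc M) y m) = (fun l z => (∏ i ∈ Finset.range n, stepScale d Lc (lev (i + 1 + 1))) * compLinAvgAt (fun i => rs (n - i + 1)) Lc n B l z) l y := fun l y m => by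
        show _ * _ = _ * _
        rw [compLinAvgAt_periodic Lc (fine Lc M) n _ B hB]
      have hHl : ∀ (l : Fin (d + 1)) (y m : Site (d + 1)),
          (fun l z => (∏ i ∈ Finset.range n, stepScale d Lc (lev (i + 1 + 1))) * compLinAvgAt (fun i => rs (n - i + 1)) Lc n H l z) l (translate (fine Lc M) y m) = (fun l z => (∏ i ∈ Finset.range n, stepScale d Lc (lev (i + 1 + 1))) * compLinAvgAt (fun i => rs (n - i + 1)) Lc n H l z) l y := fun l y m => by
        show _ * _ = _ * _
        rw [compLinAvgAt_periodic Lc (fine Lc M) n _ H hH]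
      have htop := vhKerAt_form_translate Lc M (toSite (rs 1)) (fun l z => (∏ i ∈ Finset.range n, stepScale d Lc (lev (i + 1 + 1))) * compLinAvgAt (fun i => rs (n - i + 1)) Lc n H l z) (fun l z => (∏ i ∈ Finset.range n, stepScale d Lc (lev (i + 1 + 1))) * compLinAvgAt (fun i => rs (n - i + 1)) Lc n B l z) hHl hBl l y t
      have hlow := linAvgAt_translate_of_periodic Lc M (toSite (rs 1)) _ IH' l y t
      rw [hsucc, hsucc, hlow]
      exact congrArg (fun s : ℝ => (((Lc : ℝ) ^ (d + 1) * stepScale d Lc (lev 1)) * (∏ i ∈ Finset.range n, (stepScale d Lc (lev (i + 1 + 1)) * ((box (d + 1) Lc).card : ℝ)))⁻¹) * s + _) htop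

/-- [folklore] **`sum_compIns₁_mul_periodic'` — R-7's junction WITHOUT the letter `hper`** (supplied by `periodic_of_clauses`). -/
theorem sum_compIns₁_mul_periodic'
    (𝓘 : (ℕ → ℕ) → (ℕ → (Fin (d + 1) → ℕ)) → ℕ → Form1 (d + 1) ℝ → Form1 (d + 1) ℝ → Form1 (d + 1) ℝ)
    (h0 : ∀ (lev : ℕ → ℕ) (rs : ℕ → (Fin (d + 1) → ℕ)) (H B : Form1 (d + 1) ℝ), 𝓘 lev rs 0 H B = 0)
    (hsucc : ∀ (lev : ℕ → ℕ) (rs : ℕ → (Fin (d + 1) → ℕ)) (n : ℕ) (H B : Form1 (d + 1) ℝ) (κ : Fin (d + 1)) (x : Site (d + 1)),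
      𝓘 lev rs (n + 1) H B κ x
        = (((Lc : ℝ) ^ (d + 1) * stepScale d Lc (lev 1)) * (∏ i ∈ Finset.range n, (stepScale d Lc (lev (i + 1 + 1)) * ((box (d + 1) Lc).card : ℝ)))⁻¹) *
            (∑' u : Site (d + 1), ∑ κ' : Fin (d + 1),
              (∑' z : Site (d + 1), ∑ l : Fin (d + 1), vhKerAt (toSite (rs 1)) Lc κ x (l, z) (κ', u) *
                ((∏ i ∈ Finset.range n, stepScale d Lc (lev (i + 1 + 1))) * compLinAvgAt (fun i => rs (n - i + 1)) Lc n B l z)) *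
              ((∏ i ∈ Finset.range n, stepScale d Lc (lev (i + 1 + 1))) * compLinAvgAt (fun i => rs (n - i + 1)) Lc n H κ' u))
          + stepScale d Lc (lev 1) * linAvgAt (toSite (rs 1)) (𝓘 (fun k => lev (k + 1)) (fun k => rs (k + 1)) n H B) Lc κ x)
    (n : ℕ) (M : Fin (d + 1) → ℕ) [∀ μ, NeZero (M μ)] (lev : ℕ → ℕ) (rs : ℕ → (Fin (d + 1) → ℕ)) (hrs : ∀ k, rs k ∈ box (d + 1) Lc)
    (h : ↥(pbox (towerTorus Lc M n)) × Fin (d + 1) → ℝ) (B : Form1 (d + 1) ℝ)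
    (hB : ∀ (l : Fin (d + 1)) (w t : Site (d + 1)), B l (translate (towerTorus Lc M n) w t) = B l w) (x : ↥(pbox M)) (κ : Fin (d + 1)) :
    ∑ q : ↥(pbox (towerTorus Lc M n)) × Fin (d + 1), compIns₁ Lc M lev rs n h (x, κ) q * B q.2 (q.1 : Site (d + 1))
      = 𝓘 lev rs n (fun l w => h (wrapPt (towerTorus Lc M n) w, l)) B κ (x : Site (d + 1)) :=
  sum_compIns₁_mul_periodic Lc 𝓘 h0 hsucc (fun lev rs n M H B => periodic_of_clauses Lc 𝓘 h0 hsucc n lev rs M H B) n M lev rs hrs h B hB x κ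


/-! ## §4 The entries of `compIns₁ … n h`: the functional at (the lift of `h`, the periodic indicator of a torus bond) -/

/-- [folklore] **THE ENTRIES OF THE COMPOSITE FIRST-ORDER INSERTION JET** (R-1 `compRows_apply_eq_compLinAvgAt_wrap`'s pattern one order up): for any `𝓘` with the
clauses `h0 ∕ hsucc`, `compIns₁ Lc M lev rs n h (x, κ) (z, β) = 𝓘 lev rs n (lift h) ((l, w) ↦ δ_{(β,z)} (l, wrap T w)) κ x`, `T = towerTorus Lc M n` (§3 at the
periodic indicator of the torus bond `(z, β)`) — the matrix-level reading the (S3-2) naming `hQF₁` consumes. -/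
theorem compIns₁_apply_eq
    (𝓘 : (ℕ → ℕ) → (ℕ → (Fin (d + 1) → ℕ)) → ℕ → Form1 (d + 1) ℝ → Form1 (d + 1) ℝ → Form1 (d + 1) ℝ)
    (h0 : ∀ (lev : ℕ → ℕ) (rs : ℕ → (Fin (d + 1) → ℕ)) (H B : Form1 (d + 1) ℝ), 𝓘 lev rs 0 H B = 0)
    (hsucc : ∀ (lev : ℕ → ℕ) (rs : ℕ → (Fin (d + 1) → ℕ)) (n : ℕ) (H B : Form1 (d + 1) ℝ) (κ : Fin (d + 1)) (x : Site (d + 1)),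
      𝓘 lev rs (n + 1) H B κ x
        = (((Lc : ℝ) ^ (d + 1) * stepScale d Lc (lev 1)) * (∏ i ∈ Finset.range n, (stepScale d Lc (lev (i + 1 + 1)) * ((box (d + 1) Lc).card : ℝ)))⁻¹) *
            (∑' u : Site (d + 1), ∑ κ' : Fin (d + 1),
              (∑' z : Site (d + 1), ∑ l : Fin (d + 1), vhKerAt (toSite (rs 1)) Lc κ x (l, z) (κ', u) *
                ((∏ i ∈ Finset.range n, stepScale d Lc (lev (i + 1 + 1))) * compLinAvgAt (fun i => rs (n - i + 1)) Lc n B l z)) *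
              ((∏ i ∈ Finset.range n, stepScale d Lc (lev (i + 1 + 1))) * compLinAvgAt (fun i => rs (n - i + 1)) Lc n H κ' u))
          + stepScale d Lc (lev 1) * linAvgAt (toSite (rs 1)) (𝓘 (fun k => lev (k + 1)) (fun k => rs (k + 1)) n H B) Lc κ x)
    (n : ℕ) (M : Fin (d + 1) → ℕ) [∀ μ, NeZero (M μ)] (lev : ℕ → ℕ) (rs : ℕ → (Fin (d + 1) → ℕ)) (hrs : ∀ k, rs k ∈ box (d + 1) Lc)
    (h : ↥(pbox (towerTorus Lc M n)) × Fin (d + 1) → ℝ) (x : ↥(pbox M)) (κ : Fin (d + 1)) (z : ↥(pbox (towerTorus Lc M n))) (β : Fin (d + 1)) :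
    compIns₁ Lc M lev rs n h (x, κ) (z, β)
      = 𝓘 lev rs n (fun l w => h (wrapPt (towerTorus Lc M n) w, l))
          (fun l w => KKTFluctuationKernel.delta1 β (z : Site (d + 1)) l (wrap (towerTorus Lc M n) w)) κ (x : Site (d + 1)) := by
  classical
  have hA : ∀ (l : Fin (d + 1)) (w t : Site (d + 1)),
      (fun l w => KKTFluctuationKernel.delta1 β (z : Site (d + 1)) l (wrap (towerTorus Lc M n) w)) l (translate (towerTorus Lc M n) w t)
        = (fun l w => KKTFluctuationKernel.delta1 β (z : Site (d + 1)) l (wrap (towerTorus Lc M n) w)) l w := fun l w t => by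
    show KKTFluctuationKernel.delta1 β _ l (wrap _ (translate _ w t)) = KKTFluctuationKernel.delta1 β _ l (wrap _ w)
    rw [wrap_congr (x' := w)]
    intro i
    rw [translate_apply]
    exact ⟨t i, by ring⟩
  rw [← sum_compIns₁_mul_periodic' Lc 𝓘 h0 hsucc n M lev rs hrs h _ hA x κ]
  have hval : ∀ q : ↥(pbox (towerTorus Lc M n)) × Fin (d + 1),
      (fun l w => KKTFluctuationKernel.delta1 β (z : Site (d + 1)) l (wrap (towerTorus Lc M n) w)) q.2 (q.1 : Site (d + 1))
        = if q = (z, β) then 1 else 0 := fun q => by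
    show KKTFluctuationKernel.delta1 β _ q.2 (wrap _ _) = _
    rw [B6Lemma24Torus.wrap_eq_self q.1.2, KKTFluctuationKernel.delta1_apply]
    obtain ⟨w, l⟩ := q
    by_cases hq : (w, l) = (z, β)
    · rw [if_pos hq, if_pos]
      obtain ⟨h1, h2⟩ := Prod.mk.inj hq
      exact ⟨h2, by rw [h1]⟩
    · rw [if_neg hq, if_neg]
      rintro ⟨h2, h1⟩
      exact hq (Prod.ext (Subtype.ext h1) h2)
  simp only [hval, mul_ite, mul_one, mul_zero, Finset.sum_ite_eq', Finset.mem_univ, if_true]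

end Summit.QuantumFields.BalabanUV.Beta.FP.TorusCompositeInsertionPeriodic

end
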